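import Summits.RiemannHypothesis.RiemannHypothesis.Theorems.PfPersistenceEdgeLawDefect
import Summits.RiemannHypothesis.RiemannHypothesis.Theorems.WeilWindowFlowWindowLipschitzStubCommutatorBoundAux
import Summits.RiemannHypothesis.RiemannHypothesis.Theorems.WeilWindowFlowWindowLipschitzStubBarrierEnergy
import HarnessLib

/-!
# The edge layer of a Weil ground state: geometry and the energy estimate (RH-free helper)

Mechanism / rigidity campaign `pub-rhpf` (theory seat 2, gen 4); **no RH claims** — nothing here
touches `RiemannHypothesis`, `WindowPositivity` or the parity crux.

Second part of the reduction of the typed log-Pohozaev hypothesis `PfPersistence.WeilLogPohozaevAt`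
(theory-1, R6) to layer regularity. By `PfPersistenceEdgeLawDefect` the dilation virial is the
defect-energy rate of `w_η = ũ_η − ũ`, and on the EDGE LAYERS `a/(1+η) ≤ |x| < a` one has `w_η = −ũ`.
This file treats the layer piece `σ_h = weilEdgeLayer a u h := ũ · 1_{a − h < |x|}`:
`‖σ_h‖² = edgeMass ũ a h = edgeMass u a h`; LAYER GEOMETRY `D_t(σ_h) = 2‖σ_h‖²` for
`h ≤ t ≤ 2a − 2h` (translates of a layer function are disjoint from it: the increments SATURATE
beyond the layer scale); the crude bounds `D_t ≤ 4‖·‖²`, `|P(f)| ≤ C_a^P ‖f‖²` (window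
Cauchy–Schwarz) and the Coulomb count `|∫_{h<t≤T} ρ − ½ log(T/h)| ≤ T`; and THE LAYER ENERGY
ESTIMATE `|D_a(σ_h) − (log(1/h) ‖σ_h‖² + L_a(u,h))| ≤ K_a ‖σ_h‖²` (`0 < h ≤ min a 1 / 2`), with
`L_a(u,h) = edgeLayerLocalEnergy a u h = ∫_{0<t≤h} ρ D_t(σ_h)` the sub-layer-scale energy. Hence
`D_a(σ_h)/h → I` as soon as `log(1/h)‖σ_h‖²/h → I` (edge intensity) and `L_a(u,h)/h → 0`
(sibling file `PfPersistenceEdgeLawPohozaev`).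

Reference: [Bombieri2000Weil] E. Bombieri, Rend. Mat. Acc. Lincei (9) 11 (2000) 183–233, §4, §6.
-/

set_option linter.dupNamespace false

noncomputable section

open MeasureTheory Set Filter
open scoped Topology ComplexConjugate

namespace Summit.RiemannHypothesis.RiemannHypothesis.Theorems.PfPersistence

open Literature.NumberTheory.LFunctions
open Summit.RiemannHypothesis.RiemannHypothesis.Theorems.WeilWindowFlowWindowLipschitz
  (stub_groundStateEnergy stub_commutatorBound_measurableSet_layer
    stub_barrierEnergy_weilIncrement_le_four)
open Summit.RiemannHypothesis.RiemannHypothesis.Theorems.EvenWinsBeyondArch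

variable {a : ℝ} {u f : ℝ → ℂ}

/-! ## The edge layer -/

/-- The **edge layer of depth `h`** of a window state: `σ_h := ũ · 1_{a − h < |x|}` (both edges;
`ũ = 1_{(−a,a)} u`). For `h(η) = aη/(1+η)` this is minus the dilation defect on the layers.
[cite: Bombieri2000Weil, §6] -/
def weilEdgeLayer (a : ℝ) (u : ℝ → ℂ) (h : ℝ) : ℝ → ℂ :=
  {x : ℝ | a - h < |x|}.indicator (weilTrunc a u)

/-- The **local (sub-layer-scale) layer energy** `L_a(u, h) := ∫_{0 < t ≤ h} ρ(t) D_t(σ_h) dt`.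
[cite: Bombieri2000Weil, §4 Thm 3] -/
def edgeLayerLocalEnergy (a : ℝ) (u : ℝ → ℂ) (h : ℝ) : ℝ :=
  ∫ t in Ioc 0 h, weilArchDensity t * weilIncrement (weilEdgeLayer a u h) t

/-- On the layer the layer function is `ũ`. [folklore] -/
theorem weilEdgeLayer_apply_of_lt {x h : ℝ} (hx : a - h < |x|) :
    weilEdgeLayer a u h x = weilTrunc a u x :=
  Set.indicator_of_mem (show x ∈ {x : ℝ | a - h < |x|} from hx) _

/-- On the core the layer function vanishes. [folklore] -/
theorem weilEdgeLayer_apply_of_le {x h : ℝ} (hx : |x| ≤ a - h) : weilEdgeLayer a u h x = 0 :=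
  Set.indicator_of_notMem (show x ∉ {x : ℝ | a - h < |x|} from fun h' ↦ (not_lt.2 hx) h') _

/-- The layer function vanishes outside the window: `σ_h(x) = 0` for `a ≤ |x|`. [folklore] -/
theorem weilEdgeLayer_eq_zero_of_le_abs (h : ℝ) {x : ℝ} (hx : a ≤ |x|) :
    weilEdgeLayer a u h x = 0 := by
  by_cases hm : a - h < |x|
  · rw [weilEdgeLayer_apply_of_lt hm, weilTrunc_eq_zero u hx]
  · exact weilEdgeLayer_apply_of_le (not_lt.1 hm)

/-- Where the layer function is non-zero: `σ_h(y) ≠ 0 ⇒ a − h < |y| < a`. [folklore] -/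
theorem layer_of_weilEdgeLayer_ne_zero {y h : ℝ} (hy : weilEdgeLayer a u h y ≠ 0) :
    a - h < |y| ∧ |y| < a := by
  constructor
  · by_contra hc
    exact hy (weilEdgeLayer_apply_of_le (not_lt.1 hc))
  · by_contra hc
    exact hy (weilEdgeLayer_eq_zero_of_le_abs h (not_lt.1 hc))

/-- The layer function of a ground state is in `L²`. [folklore] -/
theorem memLp_weilEdgeLayer (hu : IsWeilGroundState a u) (h : ℝ) :
    MemLp (weilEdgeLayer a u h) 2 :=
  MemLp.indicator (stub_commutatorBound_measurableSet_layer a h)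
    (isWeilGroundState_weilTrunc hu).memLp

/-- `‖σ_h‖² = edgeMass ũ a h`. [folklore] -/
theorem integral_norm_sq_weilEdgeLayer (h : ℝ) :
    ∫ x, ‖weilEdgeLayer a u h x‖ ^ 2 = edgeMass (weilTrunc a u) a h := by
  unfold edgeMass
  rw [← integral_indicator (stub_commutatorBound_measurableSet_layer a h)]
  congr 1 with x
  unfold weilEdgeLayer
  by_cases hx : x ∈ {x : ℝ | a - h < |x|}
  · rw [Set.indicator_of_mem hx, Set.indicator_of_mem hx]
  · rw [Set.indicator_of_notMem hx, Set.indicator_of_notMem hx, norm_zero, zero_pow two_ne_zero]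

/-- The edge mass does not see the null modification `u ↦ ũ`: `edgeMass ũ = edgeMass u` for a
ground state. [folklore] -/
theorem edgeMass_weilTrunc (hu : IsWeilGroundState a u) (r : ℝ) :
    edgeMass (weilTrunc a u) a r = edgeMass u a r := by
  unfold edgeMass
  refine integral_congr_ae ?_
  filter_upwards [ae_restrict_of_ae (ae_eq_weilTrunc hu)] with x hx
  rw [← hx]

/-- The edge intensity does not see `u ↦ ũ`. [folklore] -/
theorem hasEdgeIntensity_weilTrunc (hu : IsWeilGroundState a u) {I : ℝ}
    (hI : HasEdgeIntensity u a I) : HasEdgeIntensity (weilTrunc a u) a I := by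
  unfold HasEdgeIntensity at hI ⊢
  simpa only [edgeMass_weilTrunc hu] using hI

/-! ## Layer geometry: the increments saturate beyond the layer scale -/

/-- **Layer geometry.** If `f ∈ L²` lives on the two layers `a − h < |y| < a`, then for
`h ≤ t ≤ 2a − 2h` the translate `f(· + t)` and `f` have disjoint supports, so
`D_t(f) = 2‖f‖²`. [folklore] -/
theorem weilIncrement_eq_two_mul_of_layer {f : ℝ → ℂ} {a h t : ℝ} (hf : MemLp f 2)
    (hfl : ∀ y, f y ≠ 0 → a - h < |y| ∧ |y| < a) (hht : h ≤ t) (ht : t ≤ 2 * a - 2 * h) :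
    weilIncrement f t = 2 * ∫ x, ‖f x‖ ^ 2 := by
  have hi2 : Integrable fun x ↦ ‖f x‖ ^ 2 := (memLp_two_iff_integrable_sq_norm hf.1).1 hf
  have hpt : ∀ x, ‖f (x + t) - f x‖ ^ 2 = ‖f (x + t)‖ ^ 2 + ‖f x‖ ^ 2 := fun x ↦ by
    by_cases hx : f x = 0
    · simp [hx]
    · have hxt : f (x + t) = 0 := by
        by_contra hne
        obtain ⟨h1, h2⟩ := hfl x hx
        obtain ⟨h3, h4⟩ := hfl (x + t) hne
        rw [abs_lt] at h2 h4
        rw [lt_abs] at h1 h3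
        rcases h1 with h1 | h1 <;> rcases h3 with h3 | h3 <;> linarith
      simp [hxt]
  unfold weilIncrement
  simp_rw [hpt]
  rw [integral_add (hi2.comp_add_right t) hi2, integral_add_right_eq_self (fun x ↦ ‖f x‖ ^ 2) t]
  ring

/-- The layer function of depth `h` lives on the layers. [folklore] -/
theorem weilIncrement_weilEdgeLayer_eq_two_mul (hu : IsWeilGroundState a u) {h t : ℝ}
    (hht : h ≤ t) (ht : t ≤ 2 * a - 2 * h) :
    weilIncrement (weilEdgeLayer a u h) t = 2 * edgeMass (weilTrunc a u) a h := by
  rw [weilIncrement_eq_two_mul_of_layer (memLp_weilEdgeLayer hu h)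
    (fun y hy ↦ layer_of_weilEdgeLayer_ne_zero hy) hht ht, integral_norm_sq_weilEdgeLayer]

/-! ## Crude bounds: increments, primes, pole -/

/-- The prime part of the energy is between `0` and `4 S_a ‖f‖²`, `S_a = Σ_{log n < 2a} Λ(n)/√n`.
[folklore] -/
theorem prime_sum_weilIncrement_le {f : ℝ → ℂ} (hf : MemLp f 2) (a : ℝ) :
    0 ≤ ∑ n ∈ weilPrimeIndex a, (ArithmeticFunction.vonMangoldt n : ℝ) / Real.sqrt n *
        weilIncrement f (Real.log n) ∧
    ∑ n ∈ weilPrimeIndex a, (ArithmeticFunction.vonMangoldt n : ℝ) / Real.sqrt n *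
        weilIncrement f (Real.log n)
      ≤ 4 * (∑ n ∈ weilPrimeIndex a, (ArithmeticFunction.vonMangoldt n : ℝ) / Real.sqrt n) *
        ∫ x, ‖f x‖ ^ 2 := by
  have hc : ∀ n : ℕ, 0 ≤ (ArithmeticFunction.vonMangoldt n : ℝ) / Real.sqrt n := fun n ↦
    div_nonneg ArithmeticFunction.vonMangoldt_nonneg (Real.sqrt_nonneg _)
  refine ⟨Finset.sum_nonneg fun n _ ↦ mul_nonneg (hc n) (weilIncrement_nonneg _ _), ?_⟩
  rw [mul_comm (4 : ℝ), mul_assoc, Finset.sum_mul]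
  exact Finset.sum_le_sum fun n _ ↦
    mul_le_mul_of_nonneg_left (stub_barrierEnergy_weilIncrement_le_four hf _) (hc n)

/-- **Window Cauchy–Schwarz.** For `f ∈ L²` vanishing on `|x| ≥ a` and a continuous real weight
`φ`: `‖∫ f φ‖² ≤ ‖f‖² · ∫_{[-a,a]} φ²`. [folklore] -/
theorem norm_sq_integral_mul_le_window {f : ℝ → ℂ} {a : ℝ} (hf : MemLp f 2)
    (hfs : ∀ x, a ≤ |x| → f x = 0) {φ : ℝ → ℝ} (hφ : Continuous φ) :
    ‖∫ x, f x * (φ x : ℂ)‖ ^ 2 ≤ (∫ x, ‖f x‖ ^ 2) * ∫ x in Icc (-a) a, φ x ^ 2 := by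
  set k : ℝ → ℝ := (Icc (-a) a).indicator fun x ↦ |φ x| with hk
  have hf0 : ∀ x, x ∉ Icc (-a) a → f x = 0 := fun x hx ↦ eq_zero_of_notMem_Icc_of_abs hfs x hx
  have hpt : ∀ x, ‖f x * (φ x : ℂ)‖ = ‖f x‖ * k x := by
    intro x
    by_cases hx : x ∈ Icc (-a) a
    · rw [hk, Set.indicator_of_mem hx, norm_mul, Complex.norm_real, Real.norm_eq_abs]
    · rw [hk, Set.indicator_of_notMem hx, hf0 x hx, zero_mul, norm_zero, mul_zero]
  have hk2f : (fun x ↦ k x ^ 2) = (Icc (-a) a).indicator fun x ↦ φ x ^ 2 := by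
    funext x
    by_cases hx : x ∈ Icc (-a) a
    · rw [hk, Set.indicator_of_mem hx, Set.indicator_of_mem hx, sq_abs]
    · rw [hk, Set.indicator_of_notMem hx, Set.indicator_of_notMem hx, zero_pow two_ne_zero]
  have hu2 : Integrable fun x ↦ ‖f x‖ ^ 2 := (memLp_two_iff_integrable_sq_norm hf.1).1 hf
  have hk2 : Integrable fun x ↦ k x ^ 2 := by
    rw [hk2f]
    exact ((hφ.pow 2).continuousOn.integrableOn_Icc).integrable_indicator measurableSet_Icc
  have huk : Integrable fun x ↦ ‖f x‖ * k x :=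
    ((dt_integrable_mul_continuous hf hf0 (φ := fun x ↦ (φ x : ℂ)) (by fun_prop)).norm).congr
      (Eventually.of_forall hpt)
  have h1 : ‖∫ x, f x * (φ x : ℂ)‖ ≤ ∫ x, ‖f x‖ * k x := by
    refine (norm_integral_le_integral_norm _).trans_eq ?_
    exact integral_congr_ae (Eventually.of_forall hpt)
  have h1' : 0 ≤ ∫ x, ‖f x‖ * k x := (norm_nonneg _).trans h1
  have hq : ∀ s : ℝ, 0 ≤ (∫ x, k x ^ 2) * (s * s) + (2 * ∫ x, ‖f x‖ * k x) * s +
      ∫ x, ‖f x‖ ^ 2 := by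
    intro s
    have he : (fun x ↦ (s * k x + ‖f x‖) ^ 2) =
        fun x ↦ s ^ 2 * k x ^ 2 + 2 * s * (‖f x‖ * k x) + ‖f x‖ ^ 2 := by
      funext x; ring
    have h0 : 0 ≤ ∫ x, (s * k x + ‖f x‖) ^ 2 := integral_nonneg fun x ↦ sq_nonneg _
    have hA : Integrable fun x ↦ s ^ 2 * k x ^ 2 + 2 * s * (‖f x‖ * k x) :=
      (hk2.const_mul _).add (huk.const_mul _)
    rw [he, integral_add hA hu2, integral_add (hk2.const_mul _) (huk.const_mul _),
      integral_const_mul, integral_const_mul] at h0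
    have e2 : (∫ x, k x ^ 2) * (s * s) + (2 * ∫ x, ‖f x‖ * k x) * s + ∫ x, ‖f x‖ ^ 2 =
        s ^ 2 * (∫ x, k x ^ 2) + 2 * s * (∫ x, ‖f x‖ * k x) + ∫ x, ‖f x‖ ^ 2 := by ring
    rw [e2]
    exact h0
  have hd := discrim_le_zero hq
  rw [discrim] at hd
  have hCS : (∫ x, ‖f x‖ * k x) ^ 2 ≤ (∫ x, ‖f x‖ ^ 2) * ∫ x, k x ^ 2 := by nlinarith [hd]
  calc ‖∫ x, f x * (φ x : ℂ)‖ ^ 2 ≤ (∫ x, ‖f x‖ * k x) ^ 2 := pow_le_pow_left₀ (norm_nonneg _) h1 2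
    _ ≤ (∫ x, ‖f x‖ ^ 2) * ∫ x, k x ^ 2 := hCS
    _ = (∫ x, ‖f x‖ ^ 2) * ∫ x in Icc (-a) a, φ x ^ 2 := by
        rw [hk2f, integral_indicator measurableSet_Icc]

/-- The **pole constant of the window**: `C_a^P := 2 ∫_{[-a,a]} cosh²(x/2) + 2 ∫_{[-a,a]} sinh²(x/2)`.
[folklore] -/
def windowPoleConstant (a : ℝ) : ℝ :=
  2 * (∫ x in Icc (-a) a, Real.cosh (x / 2) ^ 2) + 2 * ∫ x in Icc (-a) a, Real.sinh (x / 2) ^ 2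

/-- **The pole form is `L²`-bounded on a window**: `|P(f)| ≤ C_a^P ‖f‖²` for `f ∈ L²` vanishing on
`|x| ≥ a`. [folklore] -/
theorem abs_weilPoleForm_le_window {f : ℝ → ℂ} {a : ℝ} (hf : MemLp f 2)
    (hfs : ∀ x, a ≤ |x| → f x = 0) :
    |weilPoleForm f| ≤ windowPoleConstant a * ∫ x, ‖f x‖ ^ 2 := by
  have hc := norm_sq_integral_mul_le_window hf hfs (φ := fun x ↦ Real.cosh (x / 2)) (by fun_prop)
  have hs := norm_sq_integral_mul_le_window hf hfs (φ := fun x ↦ Real.sinh (x / 2)) (by fun_prop)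
  have h0c := sq_nonneg ‖∫ x, f x * (Real.cosh (x / 2) : ℂ)‖
  have h0s := sq_nonneg ‖∫ x, f x * (Real.sinh (x / 2) : ℂ)‖
  unfold weilPoleForm windowPoleConstant
  rw [abs_le]
  constructor <;> linarith [hc, hs, h0c, h0s]

/-! ## The Coulomb count of the archimedean density -/

/-- **Coulomb count.** For `0 < h ≤ T ≤ 1`: `|∫_{h < t ≤ T} ρ(t) dt − ½ log(T/h)| ≤ T`
(`|ρ(t) − 1/(2t)| ≤ 1` on `(0, 1]`). [folklore] -/
theorem abs_integral_weilArchDensity_sub_log_le {h T : ℝ} (hh : 0 < h) (hhT : h ≤ T) (hT1 : T ≤ 1) :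
    |(∫ t in Ioc h T, weilArchDensity t) - 1 / 2 * Real.log (T / h)| ≤ T := by
  have hT : 0 < T := hh.trans_le hhT
  have hIcc : ∀ x ∈ uIcc h T, 0 < x := fun x hx ↦ by
    rw [uIcc_of_le hhT] at hx
    exact hh.trans_le hx.1
  have hρi : IntervalIntegrable weilArchDensity volume h T := by
    refine ((integrableOn_weilArchDensity_Ioi (half_pos hh)).mono_set fun x hx ↦ ?_).intervalIntegrable
    exact (half_lt_self hh).trans_le ((uIcc_of_le hhT ▸ hx : x ∈ Icc h T).1)
  have hinv : IntervalIntegrable (fun x : ℝ ↦ x⁻¹) volume h T :=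
    intervalIntegral.intervalIntegrable_inv (fun x hx ↦ (hIcc x hx).ne') continuousOn_id
  have hinv2 : IntervalIntegrable (fun x : ℝ ↦ 1 / 2 * x⁻¹) volume h T := hinv.const_mul _
  have hlog : ∫ x in h..T, 1 / 2 * x⁻¹ = 1 / 2 * Real.log (T / h) := by
    rw [intervalIntegral.integral_const_mul, integral_inv_of_pos hh hT]
  have hdiff : ∫ x in h..T, (weilArchDensity x - 1 / 2 * x⁻¹) =
      (∫ t in Ioc h T, weilArchDensity t) - 1 / 2 * Real.log (T / h) := by
    rw [intervalIntegral.integral_sub hρi hinv2, hlog, intervalIntegral.integral_of_le hhT]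
  rw [← hdiff]
  have hb : ∀ x ∈ Set.uIoc h T, ‖weilArchDensity x - 1 / 2 * x⁻¹‖ ≤ 1 := fun x hx ↦ by
    rw [uIoc_of_le hhT] at hx
    rw [Real.norm_eq_abs, show (1 : ℝ) / 2 * x⁻¹ = 1 / (2 * x) by rw [one_div, one_div, mul_inv]]
    exact abs_weilArchDensity_sub_le (hh.trans hx.1) (hx.2.trans hT1)
  have := intervalIntegral.norm_integral_le_of_norm_le_const hb
  rw [Real.norm_eq_abs, abs_of_nonneg (sub_nonneg.2 hhT), one_mul] at this
  linarith

/-! ## The layer energy estimate -/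

/-- The **layer constant** `K_a := C_a^P + 4 S_a + |log T₀| + 2 T₀ + 4 ∫_{T₀ < t} ρ + |M_a + ε(a)|`,
`T₀ = min a 1`, `S_a = Σ_{log n < 2a} Λ(n)/√n`. [folklore] -/
def layerConstant (a : ℝ) : ℝ :=
  windowPoleConstant a +
    4 * (∑ n ∈ weilPrimeIndex a, (ArithmeticFunction.vonMangoldt n : ℝ) / Real.sqrt n) +
    (|Real.log (min a 1)| + 2 * min a 1) + 4 * (∫ t in Ioi (min a 1), weilArchDensity t) +
    |weilMarkovConstant a + weilGroundEnergy a|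

/-- **Layer energy bookkeeping** (abstract form). For `σ ∈ L²` vanishing on `|x| ≥ a` with
`‖σ‖² = m`, finite energy, and SATURATED increments `D_t(σ) = 2m` for `h ≤ t ≤ 2a − 2h`
(`0 < h ≤ min a 1 / 2`): `|D_a(σ) − (log(1/h) m + ∫_{(0,h]} ρ D_t(σ))| ≤ K_a m`.
Split `∫_{Ioi 0} = ∫_{(0,h]} + ∫_{(h,T₀]} + ∫_{(T₀,∞)}`; middle `= 2m ∫_{(h,T₀]} ρ = m log(1/h) +
m (log T₀ ± 2T₀)` (Coulomb count); tail, primes (`D_t ≤ 4m`), pole (`|P| ≤ C_a^P m`) and the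
Markov shift are `O(m)`. [cite: Bombieri2000Weil, §4 Thm 3] -/
theorem abs_windowDefectForm_sub_le_of_saturated (ha : 0 < a) {σ : ℝ → ℂ} {m h : ℝ}
    (hσ2 : MemLp σ 2) (hσs : ∀ x, a ≤ |x| → σ x = 0) (hm2 : ∫ x, ‖σ x‖ ^ 2 = m)
    (hh : 0 < h) (hhT : h ≤ min a 1 / 2)
    (hsat : ∀ t, h ≤ t → t ≤ 2 * a - 2 * h → weilIncrement σ t = 2 * m)
    (hfin : IntegrableOn (fun t ↦ weilArchDensity t * weilIncrement σ t) (Ioi 0)) :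
    |windowDefectForm a σ -
        (Real.log (1 / h) * m + ∫ t in Ioc 0 h, weilArchDensity t * weilIncrement σ t)|
      ≤ layerConstant a * m := by
  have hT0 : 0 < min a 1 := lt_min ha one_pos
  have hT1 : min a 1 ≤ 1 := min_le_right _ _
  have hTa : min a 1 ≤ a := min_le_left _ _
  have hhT' : h ≤ min a 1 := by linarith
  have hm0 : 0 ≤ m := hm2 ▸ integral_nonneg fun _ ↦ by positivity
  have hF0 : ∀ t, 0 < t → 0 ≤ weilArchDensity t * weilIncrement σ t := fun t ht ↦
    mul_nonneg (weilArchDensity_pos ht).le (weilIncrement_nonneg _ _)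
  have hF4 : ∀ t, 0 < t → weilArchDensity t * weilIncrement σ t ≤ weilArchDensity t * (4 * m) :=
    fun t ht ↦ by
    rw [← hm2]
    exact mul_le_mul_of_nonneg_left (stub_barrierEnergy_weilIncrement_le_four hσ2 t)
      (weilArchDensity_pos ht).le
  -- splitting `Ioi 0 = Ioc 0 h ∪ Ioc h T₀ ∪ Ioi T₀`
  have hd1 : Disjoint (Ioc 0 h) (Ioi h) := disjoint_left.2 fun t ht ht' ↦ (not_lt.2 ht.2) ht'
  have hd2 : Disjoint (Ioc h (min a 1)) (Ioi (min a 1)) :=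
    disjoint_left.2 fun t ht ht' ↦ (not_lt.2 ht.2) ht'
  have hsplit : ∫ t in Ioi 0, weilArchDensity t * weilIncrement σ t =
      (∫ t in Ioc 0 h, weilArchDensity t * weilIncrement σ t) +
      (∫ t in Ioc h (min a 1), weilArchDensity t * weilIncrement σ t) +
      ∫ t in Ioi (min a 1), weilArchDensity t * weilIncrement σ t := by
    rw [← Ioc_union_Ioi_eq_Ioi hh.le, setIntegral_union hd1 measurableSet_Ioi
      (hfin.mono_set Ioc_subset_Ioi_self) (hfin.mono_set (Ioi_subset_Ioi hh.le)),
      ← Ioc_union_Ioi_eq_Ioi hhT', setIntegral_union hd2 measurableSet_Ioi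
      (hfin.mono_set fun t ht ↦ (hh.trans ht.1 : 0 < t))
      (hfin.mono_set (Ioi_subset_Ioi hT0.le)), add_assoc]
  -- middle range: saturated increments
  have hmid : ∫ t in Ioc h (min a 1), weilArchDensity t * weilIncrement σ t =
      2 * m * ∫ t in Ioc h (min a 1), weilArchDensity t := by
    rw [← integral_const_mul]
    refine setIntegral_congr_fun measurableSet_Ioc fun t ht ↦ ?_
    rw [hsat t ht.1.le (by linarith [ht.2])]
    ring
  -- Coulomb count, with `log(T₀/h) = log T₀ + log(1/h)`
  have hcoul := abs_integral_weilArchDensity_sub_log_le hh hhT' hT1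
  rw [Real.log_div hT0.ne' hh.ne', show Real.log h = -Real.log (1 / h) by
    rw [one_div, Real.log_inv, neg_neg], abs_le] at hcoul
  obtain ⟨hc1, hc2⟩ := hcoul
  have hc1' := mul_le_mul_of_nonneg_left hc1 (by positivity : (0 : ℝ) ≤ 2 * m)
  have hc2' := mul_le_mul_of_nonneg_left hc2 (by positivity : (0 : ℝ) ≤ 2 * m)
  have hl1 := mul_le_mul_of_nonneg_left (le_abs_self (Real.log (min a 1))) hm0
  have hl2 := mul_le_mul_of_nonneg_left (neg_abs_le (Real.log (min a 1))) hm0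
  -- tail
  have htail0 : 0 ≤ ∫ t in Ioi (min a 1), weilArchDensity t * weilIncrement σ t :=
    setIntegral_nonneg measurableSet_Ioi fun t ht ↦ hF0 t (hT0.trans ht)
  have htail : ∫ t in Ioi (min a 1), weilArchDensity t * weilIncrement σ t ≤
      4 * m * ∫ t in Ioi (min a 1), weilArchDensity t := by
    calc ∫ t in Ioi (min a 1), weilArchDensity t * weilIncrement σ t
        ≤ ∫ t in Ioi (min a 1), weilArchDensity t * (4 * m) :=
          setIntegral_mono_on (hfin.mono_set (Ioi_subset_Ioi hT0.le))
            ((integrableOn_weilArchDensity_Ioi hT0).mul_const _) measurableSet_Ioi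
            fun t ht ↦ hF4 t (hT0.trans ht)
      _ = 4 * m * ∫ t in Ioi (min a 1), weilArchDensity t := by
          rw [integral_mul_const]; ring
  have hCρ0 : 0 ≤ ∫ t in Ioi (min a 1), weilArchDensity t :=
    setIntegral_nonneg measurableSet_Ioi fun t ht ↦ (weilArchDensity_pos (hT0.trans ht)).le
  -- primes, pole, Markov shift
  obtain ⟨hP0, hP4⟩ := prime_sum_weilIncrement_le hσ2 a
  rw [hm2] at hP4
  have hpole := abs_weilPoleForm_le_window hσ2 hσs
  rw [hm2, abs_le] at hpole
  obtain ⟨hp1, hp2⟩ := hpole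
  have hM1 := mul_le_mul_of_nonneg_left (le_abs_self (weilMarkovConstant a + weilGroundEnergy a)) hm0
  have hM2 := mul_le_mul_of_nonneg_left (neg_abs_le (weilMarkovConstant a + weilGroundEnergy a)) hm0
  -- assemble
  have hD : windowDefectForm a σ = weilPoleForm σ +
      ((∑ n ∈ weilPrimeIndex a, (ArithmeticFunction.vonMangoldt n : ℝ) / Real.sqrt n *
          weilIncrement σ (Real.log n)) +
        ∫ t in Ioi 0, weilArchDensity t * weilIncrement σ t) -
      (weilMarkovConstant a + weilGroundEnergy a) * m := by
    rw [windowDefectForm, weilDirichletEnergy, hm2]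
  rw [hD, hsplit, hmid, layerConstant, abs_le]
  constructor
  · linarith [mul_nonneg hm0 hT0.le, mul_nonneg hm0 hCρ0]
  · linarith [mul_nonneg hm0 hT0.le, mul_nonneg hm0 hCρ0]

/-- **THE LAYER ENERGY ESTIMATE.** For a ground state `u` of the window `a`, `0 < h ≤ min a 1 / 2`
and a layer `σ_h` of finite energy:
`|D_a(σ_h) − (log(1/h) ‖σ_h‖² + L_a(u,h))| ≤ K_a ‖σ_h‖²`, `‖σ_h‖² = edgeMass ũ a h`.
[cite: Bombieri2000Weil, §4 Thm 3, §6] -/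
theorem windowDefectForm_weilEdgeLayer_estimate (hu : IsWeilGroundState a u) {h : ℝ}
    (hh : 0 < h) (hhT : h ≤ min a 1 / 2)
    (hfin : IntegrableOn
      (fun t ↦ weilArchDensity t * weilIncrement (weilEdgeLayer a u h) t) (Ioi 0)) :
    |windowDefectForm a (weilEdgeLayer a u h) -
        (Real.log (1 / h) * edgeMass (weilTrunc a u) a h + edgeLayerLocalEnergy a u h)|
      ≤ layerConstant a * edgeMass (weilTrunc a u) a h :=
  abs_windowDefectForm_sub_le_of_saturated hu.pos (memLp_weilEdgeLayer hu h)
    (fun _ hx ↦ weilEdgeLayer_eq_zero_of_le_abs h hx) (integral_norm_sq_weilEdgeLayer h) hh hhT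
    (fun _ hht ht ↦ weilIncrement_weilEdgeLayer_eq_two_mul hu hht ht) hfin

end Summit.RiemannHypothesis.RiemannHypothesis.Theorems.PfPersistence

end
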